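import Summits.AtomisticToContinuum.FouriersLaw.Theorems.EmbeddedDrudeMourreGreenKuboContinuationCurrentVariancePos
import Literature.MathematicalPhysics.KineticTheory.InfiniteChainShiftInvariantUniqueness
import Literature.MathematicalPhysics.KineticTheory.InfiniteChainCurrentMoments
import HarnessLib

/-!
# Stub CVG `stub_currentVariance_of_bondForce` of line `Sketch`, crux
`EmbeddedDrudeMourre.DrudeDissolution` (stmt-AtomisticToContinuum-12593): the static current
variance is dominated by the bond-force second moment

For `P = pinnedChain ω₂ lam β γ` (all four parameters `> 0`), every `T > 0`, every DLR Gibbs state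
`μ` at `T` that is shift-invariant (stated as `MeasurePreserving (σ ↦ (i ↦ σ (i+1))) μ μ`) and every
infinite-volume dynamics `D` preserving `μ`:
`C_T(0) = D.currentCorrelation μ 0 ≤ T · ∫ V'(q_1 - q_0)² dμ`.

This is the glue between the Literature identity
`InfiniteChainDynamics.currentCorrelation_zero_eq_variance`
(`C_T(0) = (T/4) ∫ (V'(r_0) + V'(r_1))² dμ`, `r_x = q_{x+1} - q_x`) and the statics
`∫ V'(r_0)² dμ ≤ B T` of the line: pointwise `(a + b)² ≤ 2a² + 2b²` and shift invariance
`∫ V'(r_1)² dμ = ∫ V'(r_0)² dμ` give `(T/4) ∫ (a+b)² ≤ (T/4) · 4 ∫ a² = T ∫ a²`. The finitely many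
moments involved are integrable because every shift-invariant DLR state of the pinned chain obeys
Buttà–Marchioro's superstability estimate
(`OscillatorChain.hasSuperstabilityEstimate_of_isShiftInvariant_pinnedChain`), whence
`exists_moment_bounds_of_hasSuperstabilityEstimate` (file
`EmbeddedDrudeMourreGreenKuboContinuationCurrentVariancePos`) applies exactly as in
`currentCorrelation_zero_pos` there.

## Contents
* `currentCorrelation_zero_le_variance` — the `P`-generic bound under the superstability estimate;
* `stub_currentVariance_of_bondForce` — the registered stub, verbatim (instance
  `P := pinnedChain ω₂ lam β γ`, `s₂ = 2`).
-/

noncomputable section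

open MeasureTheory Filter Set

namespace Summit.AtomisticToContinuum.FouriersLaw.Theorems.DrudeDissolution.LineSketch

open Literature.MathematicalPhysics.KineticTheory.HeatConduction
open Summit.AtomisticToContinuum.FouriersLaw.Theorems.GreenKuboContinuation.TemperatureBlindVitaliHurwitz

/-- **The static current variance is at most `T ∫ V'(r_0)²`.** For a chain with `U ≥ 0` continuous,
`V` an even non-negative polynomial of degree `2s₂ ≥ 2`, a dynamics `D` preserving a shift-invariant
DLR state `μ` at `T > 0` obeying the superstability estimate (2.3):
`D.currentCorrelation μ 0 ≤ T ∫ V'(q_1 - q_0)² dμ`. Indeed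
`C(0) = (T/4) ∫ (V'(r_0) + V'(r_1))² dμ` (`currentCorrelation_zero_eq_variance`, the moments being
integrable by `exists_moment_bounds_of_hasSuperstabilityEstimate`), `(a+b)² ≤ 2a² + 2b²` pointwise
and `∫ V'(r_1)² = ∫ V'(r_0)²` by shift invariance. [folklore] -/
theorem currentCorrelation_zero_le_variance {P : OscillatorChain} {s₂ : ℕ} (h₂ : 1 ≤ s₂)
    (hU0 : ∀ r, 0 ≤ P.U r) (hU : Continuous P.U) (hVp : OscillatorChain.IsEvenPolyOfDegree P.V s₂)
    (D : InfiniteChainDynamics P) {T : ℝ} (hT : 0 < T) {μ : Measure ChainConfig}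
    (hμ : P.IsChainGibbsMeasure T μ) (hshift : IsShiftInvariant μ)
    (hss : P.HasSuperstabilityEstimate μ) (hD : D.PreservesMeasure μ) :
    D.currentCorrelation μ 0 ≤ T * ∫ σ, deriv P.V ((σ 1).1 - (σ 0).1) ^ 2 ∂μ := by
  have hV : Continuous P.V := hVp.continuous
  have hV0 : ∀ r, 0 ≤ P.V r := hVp.choose_spec.2.2
  obtain ⟨c, hc, ha, hb, hI⟩ :=
    exists_moment_bounds_of_hasSuperstabilityEstimate h₂ hU0 hU.measurable hVp hss
  have hq : ∀ x : ℤ, Measurable fun σ : ChainConfig => (σ x).1 := fun x =>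
    (measurable_pi_apply x).fst
  have ham : Measurable fun σ : ChainConfig => deriv P.V ((σ 1).1 - (σ 0).1) :=
    (measurable_deriv P.V).comp ((hq 1).sub (hq 0))
  have hbm : Measurable fun σ : ChainConfig => deriv P.V ((σ 2).1 - (σ 1).1) :=
    (measurable_deriv P.V).comp ((hq 2).sub (hq 1))
  have hW0 : ∀ σ : ChainConfig, 0 ≤ P.bmLocalEnergy 0 2 σ := fun σ =>
    zero_le_one.trans (OscillatorChain.one_le_bmLocalEnergy hU0 hV0 0 2 σ)
  -- the position observables and their bounds by `W²`
  have e_a2 : ∀ σ : ChainConfig, |deriv P.V ((σ 1).1 - (σ 0).1) ^ 2| ≤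
      c ^ 2 * P.bmLocalEnergy 0 2 σ ^ 2 := fun σ => by
    rw [abs_pow, ← mul_pow]
    exact pow_le_pow_left₀ (abs_nonneg _) (ha σ) 2
  have e_b2 : ∀ σ : ChainConfig, |deriv P.V ((σ 2).1 - (σ 1).1) ^ 2| ≤
      c ^ 2 * P.bmLocalEnergy 0 2 σ ^ 2 := fun σ => by
    rw [abs_pow, ← mul_pow]
    exact pow_le_pow_left₀ (abs_nonneg _) (hb σ) 2
  have e_ab : ∀ σ : ChainConfig,
      |deriv P.V ((σ 1).1 - (σ 0).1) * deriv P.V ((σ 2).1 - (σ 1).1)| ≤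
      c ^ 2 * P.bmLocalEnergy 0 2 σ ^ 2 := fun σ => by
    rw [abs_mul]
    calc |deriv P.V ((σ 1).1 - (σ 0).1)| * |deriv P.V ((σ 2).1 - (σ 1).1)|
        ≤ (c * P.bmLocalEnergy 0 2 σ) * (c * P.bmLocalEnergy 0 2 σ) :=
          mul_le_mul (ha σ) (hb σ) (abs_nonneg _) (mul_nonneg hc (hW0 σ))
      _ = c ^ 2 * P.bmLocalEnergy 0 2 σ ^ 2 := by ring
  have e_s2 : ∀ σ : ChainConfig,
      |(deriv P.V ((σ 1).1 - (σ 0).1) + deriv P.V ((σ 2).1 - (σ 1).1)) ^ 2| ≤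
      (2 * c) ^ 2 * P.bmLocalEnergy 0 2 σ ^ 2 := fun σ => by
    rw [abs_pow, ← mul_pow]
    refine pow_le_pow_left₀ (abs_nonneg _) ((abs_add_le _ _).trans ?_) 2
    linarith [ha σ, hb σ]
  obtain ⟨ha2, hIa2⟩ := hI (c ^ 2) (fun σ => deriv P.V ((σ 1).1 - (σ 0).1) ^ 2)
    (ham.pow_const 2) e_a2
  obtain ⟨hb2, -⟩ := hI (c ^ 2) (fun σ => deriv P.V ((σ 2).1 - (σ 1).1) ^ 2)
    (hbm.pow_const 2) e_b2
  obtain ⟨hab, hIab⟩ := hI (c ^ 2)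
    (fun σ => deriv P.V ((σ 1).1 - (σ 0).1) * deriv P.V ((σ 2).1 - (σ 1).1)) (ham.mul hbm) e_ab
  obtain ⟨hs2, -⟩ := hI ((2 * c) ^ 2)
    (fun σ => (deriv P.V ((σ 1).1 - (σ 0).1) + deriv P.V ((σ 2).1 - (σ 1).1)) ^ 2)
    ((ham.add hbm).pow_const 2) e_s2
  rw [D.currentCorrelation_zero_eq_variance hU hV hT hμ hshift hD
    (fun i j h1 h2 h3 h4 => hIa2 i j (by omega) (by omega) (by omega) (by omega))
    (fun i j h1 h2 h3 h4 => hIab i j (by omega) h2 (by omega) h4) ha2 hab]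
  -- shift invariance: `∫ V'(r_1)² = ∫ V'(r_0)²`
  have hb2eq : ∫ σ, deriv P.V ((σ 2).1 - (σ 1).1) ^ 2 ∂μ =
      ∫ σ, deriv P.V ((σ 1).1 - (σ 0).1) ^ 2 ∂μ := by
    rw [← hshift.integral_comp_shift (fun σ => deriv P.V ((σ 1).1 - (σ 0).1) ^ 2)]
    simp only [shift]
    norm_num
  -- `(a + b)² ≤ 2a² + 2b²` under the integral
  have hle : ∫ σ, (deriv P.V ((σ 1).1 - (σ 0).1) + deriv P.V ((σ 2).1 - (σ 1).1)) ^ 2 ∂μ ≤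
      ∫ σ, (2 * deriv P.V ((σ 1).1 - (σ 0).1) ^ 2 + 2 * deriv P.V ((σ 2).1 - (σ 1).1) ^ 2) ∂μ :=
    integral_mono hs2 ((ha2.const_mul 2).add (hb2.const_mul 2)) fun σ => by
      dsimp only
      nlinarith [sq_nonneg (deriv P.V ((σ 1).1 - (σ 0).1) - deriv P.V ((σ 2).1 - (σ 1).1))]
  have heq : ∫ σ, (2 * deriv P.V ((σ 1).1 - (σ 0).1) ^ 2 + 2 * deriv P.V ((σ 2).1 - (σ 1).1) ^ 2) ∂μ
      = 4 * ∫ σ, deriv P.V ((σ 1).1 - (σ 0).1) ^ 2 ∂μ := by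
    rw [integral_add (ha2.const_mul 2) (hb2.const_mul 2), integral_const_mul, integral_const_mul,
      hb2eq]
    ring
  calc T / 4 * ∫ σ, (deriv P.V ((σ 1).1 - (σ 0).1) + deriv P.V ((σ 2).1 - (σ 1).1)) ^ 2 ∂μ
      ≤ T / 4 * (4 * ∫ σ, deriv P.V ((σ 1).1 - (σ 0).1) ^ 2 ∂μ) :=
        mul_le_mul_of_nonneg_left (hle.trans_eq heq) (by positivity)
    _ = T * ∫ σ, deriv P.V ((σ 1).1 - (σ 0).1) ^ 2 ∂μ := by ring

/-- **CVG `stub_currentVariance_of_bondForce`** (registered stub of line `Sketch`, crux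
`EmbeddedDrudeMourre.DrudeDissolution`, verbatim): for `P = pinnedChain ω₂ lam β γ` (all parameters
`> 0`), `T > 0`, a DLR Gibbs state `μ` at `T` that is shift-invariant and an infinite-volume
dynamics `D` preserving `μ`: `C_T(0) = D.currentCorrelation μ 0 ≤ T ∫ V'(q_1 - q_0)² dμ`.
Instance `s₂ = 2` of `currentCorrelation_zero_le_variance`: shift invariance in the
`MeasurePreserving` form is `IsShiftInvariant μ` by definition, and every shift-invariant DLR state of
the pinned chain is superstable (`hasSuperstabilityEstimate_of_isShiftInvariant_pinnedChain`).
The hypothesis `0 < γ` is not needed. [folklore] -/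
theorem stub_currentVariance_of_bondForce :
    ∀ ω₂ lam β γ : ℝ, 0 < ω₂ → 0 < lam → 0 < β → 0 < γ →
      ∀ (T : ℝ) (μ : MeasureTheory.Measure
          Literature.MathematicalPhysics.KineticTheory.HeatConduction.ChainConfig)
        (D : Literature.MathematicalPhysics.KineticTheory.HeatConduction.InfiniteChainDynamics
          (Literature.MathematicalPhysics.KineticTheory.HeatConduction.pinnedChain ω₂ lam β γ)),
        0 < T →
        (Literature.MathematicalPhysics.KineticTheory.HeatConduction.pinnedChain
            ω₂ lam β γ).IsChainGibbsMeasure T μ →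
        MeasureTheory.MeasurePreserving
          (fun σ : Literature.MathematicalPhysics.KineticTheory.HeatConduction.ChainConfig =>
            fun i : ℤ => σ (i + 1)) μ μ →
        D.PreservesMeasure μ →
        D.currentCorrelation μ 0 ≤
          T * ∫ σ, deriv (Literature.MathematicalPhysics.KineticTheory.HeatConduction.pinnedChain
            ω₂ lam β γ).V ((σ 1).1 - (σ 0).1) ^ 2 ∂μ := by
  intro ω₂ lam β γ hω hl hβ _ T μ D hT hμ hshift hD
  have hS : IsShiftInvariant μ := hshift.map_eq
  have hss : (pinnedChain ω₂ lam β γ).HasSuperstabilityEstimate μ :=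
    OscillatorChain.hasSuperstabilityEstimate_of_isShiftInvariant_pinnedChain γ hω hl.le hβ.le hT
      hμ hS
  have hU : Continuous (pinnedChain ω₂ lam β γ).U := by
    show Continuous fun q : ℝ => ω₂ * q ^ 2 / 2 + lam * q ^ 4 / 4
    fun_prop
  exact currentCorrelation_zero_le_variance one_le_two
    (OscillatorChain.pinnedChain_U_nonneg β γ hω.le hl.le) hU
    (OscillatorChain.pinnedChain_isEvenPolyOfDegree_V ω₂ lam γ hβ) D hT hμ hS hss hD

end Summit.AtomisticToContinuum.FouriersLaw.Theorems.DrudeDissolution.LineSketch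

end
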